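import Summits.ABC.IUTFork.Repair.RHSigmaLicenceSigned
import Summits.ABC.IUTFork.Repair.RHSigmaMass
import HarnessLib

/-!
# R-H ROUND 2 (generic): the SIGNED remainder `D = R_∅ − C`, and the WEIGHTED DOOR «net ω-weighted slack ≥ 0 ⟹ Cor. 3.12 up to the (1−ω) trivial mass»

abc-iut cell, rung LADDER-ABC:A2.RESCUE.H, R-H ROUND 2 seat abc-iut-rh2-q2-eq (gen 2; asked for BY NAME by the generation pass: abc-iut-rh3-gen-2 00:45:39Z
«q2-eq's `RHSigmaSignedRemainder.lean` (wanted by gen-2, gen-7 financing, gen-1 tail pricing — one def serves three lanes)», rh-lead MIN-SLICE (i)/(ii)).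
Sequel of `RHSigmaLicenceSigned.lean` (p479556: `StatementUpTo P ε ⟺ PN Σᶠ cellDeficit ≤ ε`, `PN Σᶠ cellDeficit = R_∅ − C`) and of abc-iut-rh2-w-1's
`RHSigmaMass.lean` (`cellTrivialCost`, `offTrivialMass`, `thetaImageChoice`); same generality (ANY `P : Cor312.Setting S`, bridge hypotheses).

DEFINITIONS (real numbers of a setting; `PN` = procession normalisation, Prop. 3.9 (i)):
* `signedRemainder P := PN(i ↦ Σᶠ_{v_ℚ} cellDeficit_{i,v_ℚ})` — the SIGNED averaged deficit `D(P)`: the LEAST slack of the weakened Corollary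
  (`statementUpTo_iff_signedRemainder_le`; printed Statement ⟺ `D ≤ 0`).
* `credit P := PN Σᶠ (−cellDeficit)⁺` — the total surplus of the cells whose hull out-measures the q-region; `D = R_∅ − credit`
  (`signedRemainder_eq_offRemainder_empty_sub_credit`), so every Σ-row's common binder «`R_∅ ≤ ε`» (p476178) forgoes exactly `credit`.
* `weightedDeficit P ω := PN Σᶠ ω(c)·cellDeficit(c)` for a weight `ω : cells → ℝ` — the ω-WEIGHTED signed charge (`ω ≡ 1`: `D`; `ω = 1_σ`: the signed
  on-σ charge). «`weightedDeficit P ω ≤ 0`» is the hypothesis shape of the generation pass's label-WEIGHTED / financed candidates (rh3-gen-2's `H_ω`: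
  «`PN Σ ω·σ ≥ 0`» with `σ = −cellDeficit` the cell slack), an AGGREGATE condition — weaker than the cellwise licence on `{ω > 0}`.
* `weightedTrivialMass P ω := PN Σᶠ (1 − ω(c))·cellTrivialCost(c)` — the co-weighted trivial mass (`ω = 1_σ`: rh2-w-1's `offTrivialMass P σ = B_triv(σᶜ)`).
THE WEIGHTED DOOR (PROVED): **`statementUpTo_weightedTrivialMass_of_weightedDeficit_nonpos`** — under the bridge hypotheses, for ANY weight with `ω ≤ 1`
cellwise, `weightedDeficit P ω ≤ 0 ⟹ StatementUpTo P (weightedTrivialMass P ω)`: «net ω-weighted slack ≥ 0 ⟹ Cor. 3.12 WEAKENED BY the (1−ω)-weighted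
trivial mass». Proof: `D = PN Σ ω·d + PN Σ (1−ω)·d ≤ 0 + PN Σ (1−ω)·t_triv` (each deficit `d ≤ t_triv` by q2-eq's `cellDeficit_le_qLocal_sub_image` along
the Θ-regions — the ONLY pointwise input; by `Cor312Vol.logvol_possibleImage_eq` no other possible image does better). Instances: `ω = 1_σ` gives
**`statementUpTo_offTrivialMass_of_onCharge_nonpos`** — «signed on-σ charge ≤ 0 ⟹ Cor. 3.12 up to B_triv(σᶜ)», which GENERALISES rh2-w-1's
`statementUpTo_offTrivialMass_of_licenceOn` from the cellwise licence to the aggregate sign condition (`weightedDeficit_indicator_nonpos_of_licenceOn`);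
`ω ≡ 1` is «`D ≤ 0` ⟹ Statement»; fractional `ω` is the interpolation line of rh3-gen-2 (tolerance `(1−μ_ω)·M` in MIN-SLICE currency).

HONEST FRAMING: definitions and identities about OUR typed objects; the door is an implication whose hypothesis «`weightedDeficit ≤ 0`» is an ASSUMPTION
SHAPE (never asserted for any datum); nothing here asserts that abc is proved or refuted, or that [IUTchIII] Cor. 3.12 holds or fails at any datum, or takes
a side on any author; typed ≠ proved. [claim: Mochizuki2012, status: disputed] for every IUT locution.
[cite: Mochizuki2012, IUTchIII Cor. 3.12 p. 173–174, Prop. 3.9 (i)(iii) p. 116] [cite: DupuyHilado2025, §3.9]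
-/

noncomputable section

open Set Function

namespace Summit.ABC.IUTFork.Repair.RH.SigmaLicence

open Summit.ABC.IUTFork.Thm311 Summit.ABC.IUTFork.Cor312 Summit.ABC.IUTFork.Cor312.Setting Summit.ABC.IUTFork.Cor312Vol
  Literature.IUT.LogThetaLattice Summit.ABC.IUTFork.Repair.RH.SigmaMass

variable {T : ThetaIndex} {S : Situation T} (P : Cor312.Setting S)

/-! ## §1. The signed remainder and the credit -/

/-- **The SIGNED remainder `D(P) := PN(i ↦ Σᶠ_{v_ℚ} cellDeficit_{i,v_ℚ})`** — debts and credits of all cells netted; the least slack `ε` for which the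
weakened Corollary `StatementUpTo P ε` holds (`statementUpTo_iff_signedRemainder_le`). [claim: Mochizuki2012, status: disputed] -/
@[claim "Mochizuki2012" "disputed"]
def signedRemainder : ℝ :=
  processionNormalized fun i : Fin T.lstar => ∑ᶠ vQ : T.VQ, cellDeficit P i vQ

/-- **The CREDIT `C(P) := PN Σᶠ (−cellDeficit)⁺`** — the total surplus of the cells whose packet hull out-measures the q-pilot region (licensed cells
contribute here and only here). [claim: Mochizuki2012, status: disputed] -/
@[claim "Mochizuki2012" "disputed"]
def credit : ℝ :=
  processionNormalized fun i : Fin T.lstar => ∑ᶠ vQ : T.VQ, max (-cellDeficit P i vQ) 0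

/-- **The ω-WEIGHTED signed charge `PN Σᶠ ω(c)·cellDeficit(c)`** for a weight `ω` on cells (`ω ≡ 1`: `D`; `ω = 1_σ`: the signed on-σ charge). Its
non-positivity is the generation pass's «net ω-weighted slack ≥ 0» hypothesis shape. [claim: Mochizuki2012, status: disputed] -/
@[claim "Mochizuki2012" "disputed"]
def weightedDeficit (ω : Fin T.lstar × T.VQ → ℝ) : ℝ :=
  processionNormalized fun i : Fin T.lstar => ∑ᶠ vQ : T.VQ, ω (i, vQ) * cellDeficit P i vQ

/-- **The (1−ω)-WEIGHTED trivial mass `PN Σᶠ (1 − ω(c))·cellTrivialCost(c)`** (rh2-w-1's `cellTrivialCost`; `ω = 1_σ`: `offTrivialMass P σ = B_triv(σᶜ)`).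
[claim: Mochizuki2012, status: disputed] -/
@[claim "Mochizuki2012" "disputed"]
def weightedTrivialMass (ω : Fin T.lstar × T.VQ → ℝ) : ℝ :=
  processionNormalized fun i : Fin T.lstar => ∑ᶠ vQ : T.VQ, (1 - ω (i, vQ)) * cellTrivialCost P (i, vQ)

variable {P}

/-- `D = R_∅ − C` (p479556 `avg_cellDeficit_eq_offRemainder_empty_sub_credit`). [claim: Mochizuki2012, status: disputed] -/
theorem signedRemainder_eq_offRemainder_empty_sub_credit (H : BridgeHyps P) :
    signedRemainder P = offRemainder P ∅ - credit P :=
  avg_cellDeficit_eq_offRemainder_empty_sub_credit H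

/-- `C ≥ 0`. [folklore] -/
theorem credit_nonneg' : 0 ≤ credit P := credit_nonneg P

/-- `D ≤ R_∅`: the signed remainder never exceeds the debt. [claim: Mochizuki2012, status: disputed] -/
theorem signedRemainder_le_offRemainder_empty (H : BridgeHyps P) : signedRemainder P ≤ offRemainder P ∅ :=
  avg_cellDeficit_le_offRemainder_empty H

/-- `D ≤ R_σ + (R_∅ − R_σ) = R_∅ ≥ R_σ`… and in particular `D ≤ R_σ` for every LICENSED `σ` (`R_σ = R_∅`, p476178). [claim: Mochizuki2012, status: disputed] -/
theorem signedRemainder_le_offRemainder_of_licenceOn (H : BridgeHyps P) {σ : Set (Fin T.lstar × T.VQ)} (hσ : LicenceOn P σ) :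
    signedRemainder P ≤ offRemainder P σ := by
  rw [offRemainder_eq_offRemainder_empty_of_licenceOn H hσ]
  exact signedRemainder_le_offRemainder_empty H

/-- **`StatementUpTo P ε ⟺ D ≤ ε`.** [claim: Mochizuki2012, status: disputed] -/
theorem statementUpTo_iff_signedRemainder_le (H : BridgeHyps P) (ε : ℝ) : StatementUpTo P ε ↔ signedRemainder P ≤ ε :=
  statementUpTo_iff_avg_cellDeficit_le H ε

/-- **Printed Statement ⟺ `D ≤ 0` ⟺ `R_∅ ≤ C` (debt ≤ credit).** [claim: Mochizuki2012, status: disputed] -/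
theorem statement_iff_signedRemainder_nonpos (H : BridgeHyps P) : P.Statement ↔ signedRemainder P ≤ 0 :=
  statement_iff_avg_cellDeficit_nonpos H

/-- The weakened Corollary holds with slack `D` itself. [claim: Mochizuki2012, status: disputed] -/
theorem statementUpTo_signedRemainder (H : BridgeHyps P) : StatementUpTo P (signedRemainder P) :=
  statementUpTo_avg_cellDeficit H

/-! ## §2. Weights: bookkeeping -/

/-- `ω ≡ 1`: the weighted charge is `D`. [folklore] -/
theorem weightedDeficit_one : weightedDeficit P (fun _ => 1) = signedRemainder P := by
  unfold weightedDeficit signedRemainder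
  simp only [one_mul]

/-- `ω = 1_σ`: the weighted charge is the signed ON-σ charge `PN Σᶠ 1_σ·cellDeficit`. [folklore] -/
theorem weightedDeficit_indicator (σ : Set (Fin T.lstar × T.VQ)) :
    weightedDeficit P (σ.indicator fun _ => 1) =
      processionNormalized fun i : Fin T.lstar => ∑ᶠ vQ : T.VQ,
        σ.indicator (fun c : Fin T.lstar × T.VQ => cellDeficit P c.1 c.2) (i, vQ) := by
  unfold weightedDeficit
  refine congrArg processionNormalized (funext fun i => finsum_congr fun vQ => ?_)
  by_cases h : (i, vQ) ∈ σ
  · rw [Set.indicator_of_mem h, Set.indicator_of_mem h, one_mul]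
  · rw [Set.indicator_of_notMem h, Set.indicator_of_notMem h, zero_mul]

/-- `ω = 1_σ`: the co-weighted trivial mass is rh2-w-1's `B_triv(σᶜ) = offTrivialMass P σ`. [folklore] -/
theorem weightedTrivialMass_indicator (σ : Set (Fin T.lstar × T.VQ)) :
    weightedTrivialMass P (σ.indicator fun _ => 1) = offTrivialMass P σ := by
  unfold weightedTrivialMass offTrivialMass
  refine congrArg processionNormalized (funext fun i => finsum_congr fun vQ => ?_)
  by_cases h : (i, vQ) ∈ σ
  · rw [Set.indicator_of_mem h, Set.indicator_of_notMem (Set.notMem_compl_iff.mpr h), sub_self, zero_mul]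
  · rw [Set.indicator_of_notMem h, Set.indicator_of_mem (Set.mem_compl h), sub_zero, one_mul]

/-- `ω ≡ 1`: no trivial mass is charged. [folklore] -/
theorem weightedTrivialMass_one : weightedTrivialMass P (fun _ => 1) = 0 := by
  unfold weightedTrivialMass
  simp only [sub_self, zero_mul, finsum_zero]
  exact processionNormalized_zero

/-- `ω ≡ 0`: the whole trivial mass `M` is charged. [folklore] -/
theorem weightedTrivialMass_zero : weightedTrivialMass P (fun _ => 0) = totalTrivialMass P := by
  unfold weightedTrivialMass totalTrivialMass
  simp only [sub_zero, one_mul]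

/-- Per label, `ω·cellDeficit` is finitely supported over `v_ℚ`. [folklore] -/
theorem weightedDeficit_support_finite (H : BridgeHyps P) (ω : Fin T.lstar × T.VQ → ℝ) (i : Fin T.lstar) :
    (Function.support fun vQ : T.VQ => ω (i, vQ) * cellDeficit P i vQ).Finite :=
  (cellDeficit_support_finite H i).subset fun vQ hv => by
    rw [Function.mem_support] at hv ⊢
    exact fun h0 => hv (by rw [h0, mul_zero])

/-- Per label, `(1−ω)·cellTrivialCost` is finitely supported over `v_ℚ`. [folklore] -/
theorem weightedTrivialMass_support_finite (H : BridgeHyps P) (ω : Fin T.lstar × T.VQ → ℝ) (i : Fin T.lstar) :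
    (Function.support fun vQ : T.VQ => (1 - ω (i, vQ)) * cellTrivialCost P (i, vQ)).Finite :=
  (cellTrivialCost_support_finite H i).subset fun vQ hv => by
    rw [Function.mem_support] at hv ⊢
    exact fun h0 => hv (by rw [h0, mul_zero])

/-- **The cellwise licence implies the aggregate sign condition**: `LicenceOn P σ ⟹ weightedDeficit P 1_σ ≤ 0` (each σ-cell has deficit `≤ 0`).
The converse fails in general (credits on some σ-cells may pay for debts on others). [claim: Mochizuki2012, status: disputed] -/
theorem weightedDeficit_indicator_nonpos_of_licenceOn (H : BridgeHyps P) {σ : Set (Fin T.lstar × T.VQ)} (hσ : LicenceOn P σ) :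
    weightedDeficit P (σ.indicator fun _ => 1) ≤ 0 := by
  rw [weightedDeficit_indicator]
  unfold processionNormalized
  have hle : ∀ (i : Fin T.lstar) (vQ : T.VQ),
      σ.indicator (fun c : Fin T.lstar × T.VQ => cellDeficit P c.1 c.2) (i, vQ) ≤ 0 := by
    intro i vQ
    by_cases h : (i, vQ) ∈ σ
    · rw [Set.indicator_of_mem h]
      exact cellDeficit_nonpos_of_licenceOn H hσ h
    · rw [Set.indicator_of_notMem h]
  have hsum : ∀ i : Fin T.lstar,
      ∑ᶠ vQ : T.VQ, σ.indicator (fun c : Fin T.lstar × T.VQ => cellDeficit P c.1 c.2) (i, vQ) ≤ 0 := by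
    intro i
    have h := finsum_nonneg (f := fun vQ : T.VQ =>
      -σ.indicator (fun c : Fin T.lstar × T.VQ => cellDeficit P c.1 c.2) (i, vQ)) fun vQ => neg_nonneg.mpr (hle i vQ)
    rw [finsum_neg_distrib] at h
    exact neg_nonneg.mp h
  exact div_nonpos_iff.mpr (Or.inr ⟨Finset.sum_nonpos fun i _ => hsum i, Nat.cast_nonneg _⟩)

/-! ## §3. THE WEIGHTED DOOR -/

/-- The pointwise input: every cell's deficit is at most its trivial cost (q2-eq `cellDeficit_le_qLocal_sub_image` along the Θ-regions, then `≤` the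
positive part). [claim: Mochizuki2012, status: disputed] -/
theorem cellDeficit_le_cellTrivialCost (H : BridgeHyps P) (c : Fin T.lstar × T.VQ) : cellDeficit P c.1 c.2 ≤ cellTrivialCost P c :=
  (cellDeficit_le_qLocal_sub_image H (thetaImageChoice P) c.1 c.2).trans (le_max_left _ _)

/-- **Splitting the signed remainder along a weight**: `D = PN Σᶠ ω·d + PN Σᶠ (1−ω)·d`. [folklore] -/
theorem signedRemainder_eq_weightedDeficit_add (H : BridgeHyps P) (ω : Fin T.lstar × T.VQ → ℝ) :
    signedRemainder P = weightedDeficit P ω + weightedDeficit P (fun c => 1 - ω c) := by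
  unfold signedRemainder weightedDeficit processionNormalized
  rw [← add_div, ← Finset.sum_add_distrib]
  congr 1
  refine Finset.sum_congr rfl fun i _ => ?_
  rw [← finsum_add_distrib (weightedDeficit_support_finite H ω i) (weightedDeficit_support_finite H (fun c => 1 - ω c) i)]
  exact finsum_congr fun vQ => by ring

/-- **The co-weighted charge is dominated by the co-weighted trivial mass** when `ω ≤ 1`: `PN Σᶠ (1−ω)·d ≤ PN Σᶠ (1−ω)·t_triv`.
[claim: Mochizuki2012, status: disputed] -/
theorem weightedDeficit_compl_le_weightedTrivialMass (H : BridgeHyps P) {ω : Fin T.lstar × T.VQ → ℝ} (hω : ∀ c, ω c ≤ 1) :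
    weightedDeficit P (fun c => 1 - ω c) ≤ weightedTrivialMass P ω := by
  unfold weightedDeficit weightedTrivialMass processionNormalized
  refine div_le_div_of_nonneg_right (Finset.sum_le_sum fun i _ => ?_) (Nat.cast_nonneg _)
  refine finsum_le_finsum' (weightedDeficit_support_finite H (fun c => 1 - ω c) i) (weightedTrivialMass_support_finite H ω i) fun vQ => ?_
  exact mul_le_mul_of_nonneg_left (cellDeficit_le_cellTrivialCost H (i, vQ)) (by linarith [hω (i, vQ)])

/-- **`D ≤ weightedDeficit ω + weightedTrivialMass ω`** for every weight `ω ≤ 1`. [claim: Mochizuki2012, status: disputed] -/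
theorem signedRemainder_le_weightedDeficit_add_weightedTrivialMass (H : BridgeHyps P) {ω : Fin T.lstar × T.VQ → ℝ} (hω : ∀ c, ω c ≤ 1) :
    signedRemainder P ≤ weightedDeficit P ω + weightedTrivialMass P ω := by
  rw [signedRemainder_eq_weightedDeficit_add H ω]
  linarith [weightedDeficit_compl_le_weightedTrivialMass H hω]

/-- **THE WEIGHTED DOOR: «net ω-weighted slack ≥ 0 ⟹ Cor. 3.12 WEAKENED BY the (1−ω)-weighted trivial mass».** Under the bridge hypotheses, for any
weight `ω ≤ 1` cellwise (no lower bound needed): `weightedDeficit P ω ≤ 0 ⟹ StatementUpTo P (weightedTrivialMass P ω)`. The kernel form of the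
generation pass's `H_ω` family (rh3-gen-2): hypothesis «`PN Σ ω·slack ≥ 0`», tolerance the co-weighted mass. «follows AS TYPED»; nothing asserted
about the hypothesis at any datum. [cite: Mochizuki2012, IUTchIII Cor. 3.12 p. 173–174] [claim: Mochizuki2012, status: disputed] -/
theorem statementUpTo_weightedTrivialMass_of_weightedDeficit_nonpos (H : BridgeHyps P) {ω : Fin T.lstar × T.VQ → ℝ} (hω : ∀ c, ω c ≤ 1)
    (h : weightedDeficit P ω ≤ 0) : StatementUpTo P (weightedTrivialMass P ω) :=
  (statementUpTo_iff_signedRemainder_le H _).mpr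
    ((signedRemainder_le_weightedDeficit_add_weightedTrivialMass H hω).trans (by linarith))

/-- Budget form: `weightedDeficit P ω ≤ 0` and `weightedTrivialMass P ω ≤ ε` ⟹ `StatementUpTo P ε`. [claim: Mochizuki2012, status: disputed] -/
theorem statementUpTo_of_weightedDeficit_nonpos_of_le (H : BridgeHyps P) {ω : Fin T.lstar × T.VQ → ℝ} (hω : ∀ c, ω c ≤ 1)
    (h : weightedDeficit P ω ≤ 0) {ε : ℝ} (hε : weightedTrivialMass P ω ≤ ε) : StatementUpTo P ε :=
  statementUpTo_mono hε (statementUpTo_weightedTrivialMass_of_weightedDeficit_nonpos H hω h)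

/-- More generally the hypothesis may itself carry a budget: `weightedDeficit P ω ≤ δ` ⟹ `StatementUpTo P (δ + weightedTrivialMass P ω)`.
[claim: Mochizuki2012, status: disputed] -/
theorem statementUpTo_of_weightedDeficit_le (H : BridgeHyps P) {ω : Fin T.lstar × T.VQ → ℝ} (hω : ∀ c, ω c ≤ 1) {δ : ℝ}
    (h : weightedDeficit P ω ≤ δ) : StatementUpTo P (δ + weightedTrivialMass P ω) :=
  (statementUpTo_iff_signedRemainder_le H _).mpr
    ((signedRemainder_le_weightedDeficit_add_weightedTrivialMass H hω).trans (by linarith))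

/-! ## §4. Instances: `ω = 1_σ` (aggregate licence on a stratum), `ω ≡ 1`, `ω ≡ 0` -/

/-- **«Signed ON-σ charge ≤ 0 ⟹ Cor. 3.12 up to `B_triv(σᶜ)`»** — rh2-w-1's `statementUpTo_offTrivialMass_of_licenceOn` with the CELLWISE licence on
`σ` weakened to the AGGREGATE sign condition on `σ` (credits inside `σ` may pay for debts inside `σ`). [claim: Mochizuki2012, status: disputed] -/
theorem statementUpTo_offTrivialMass_of_onCharge_nonpos (H : BridgeHyps P) {σ : Set (Fin T.lstar × T.VQ)}
    (h : weightedDeficit P (σ.indicator fun _ => 1) ≤ 0) : StatementUpTo P (offTrivialMass P σ) := by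
  rw [← weightedTrivialMass_indicator σ]
  refine statementUpTo_weightedTrivialMass_of_weightedDeficit_nonpos H (fun c => ?_) h
  by_cases hc : c ∈ σ
  · rw [Set.indicator_of_mem hc]
  · rw [Set.indicator_of_notMem hc]; exact zero_le_one

/-- Recovering rh2-w-1's cellwise door from the aggregate one. [claim: Mochizuki2012, status: disputed] -/
theorem statementUpTo_offTrivialMass_of_licenceOn' (H : BridgeHyps P) {σ : Set (Fin T.lstar × T.VQ)} (hσ : LicenceOn P σ) :
    StatementUpTo P (offTrivialMass P σ) :=
  statementUpTo_offTrivialMass_of_onCharge_nonpos H (weightedDeficit_indicator_nonpos_of_licenceOn H hσ)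

/-- `ω ≡ 1`: «`D ≤ 0` ⟹ the printed Statement» (no mass charged). [claim: Mochizuki2012, status: disputed] -/
theorem statement_of_weightedDeficit_one_nonpos (H : BridgeHyps P) (h : weightedDeficit P (fun _ => 1) ≤ 0) : P.Statement := by
  have hs := statementUpTo_weightedTrivialMass_of_weightedDeficit_nonpos H (fun _ => le_rfl) h
  rw [weightedTrivialMass_one] at hs
  exact statementUpTo_zero_iff.mp hs

/-- `ω ≡ 0`: with nothing hypothesised, Cor. 3.12 holds up to the TOTAL trivial mass `M` (the pure pilot-gap statement; bridge hypotheses only).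
[claim: Mochizuki2012, status: disputed] -/
theorem statementUpTo_totalTrivialMass (H : BridgeHyps P) : StatementUpTo P (totalTrivialMass P) := by
  have h0 : weightedDeficit P (fun _ => 0) ≤ 0 := by
    unfold weightedDeficit
    simp only [zero_mul, finsum_zero]
    exact (processionNormalized_zero).le
  have hs := statementUpTo_weightedTrivialMass_of_weightedDeficit_nonpos H (fun _ => zero_le_one) h0
  rwa [weightedTrivialMass_zero] at hs

end Summit.ABC.IUTFork.Repair.RH.SigmaLicence

end
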